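import Literature.NumberTheory.EllipticCurves.EichlerShimuraPeriods
import Literature.NumberTheory.EllipticCurves.GreenVerticallySimpleProofs
import Mathlib.Analysis.Complex.Liouville
import Mathlib.Analysis.Complex.ReImTopology
import Mathlib.Analysis.SpecialFunctions.Sqrt
import HarnessLib

/-!
# Haberland's formula, Stokes step: `∫_𝒟 φ ψ̄ yⁿ dx dy` on the standard fundamental domain as a
# boundary integral of `F ψ̄`, `F(z) = ∫_z^{i∞} φ(t)(t - z̄)ⁿ dt`

Theorems only (no definitions, no named facts). Second analytic brick of the proof of
**Haberland's formula** for cusp forms on a finite-index subgroup (V. Paşol, A. A. Popa,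
*Modular forms and period polynomials*, Proc. LMS 107 (2013), Thm. 3.2; we follow the proof of
its generalisation Thm. 8.6 in §8.2, which applies Stokes' theorem to the STANDARD fundamental
domain `𝔉 = {|x| ≤ 1/2, |z| ≥ 1}` of `SL₂(ℤ)` — the domain of the tree's `peterssonProduct` — and,
for cusp forms (`a_A = b_A = 0` there), reads
`C_k C_Γ (f, g) = ∑_A ∫_𝔉 f_A ḡ_A (z - z̄)^w dz dz̄ = ∑_A ∫_{∂𝔉} -F_A ḡ_A dz̄`,
`F_A(z) = ∫_z^{i∞} f_A(t)(t - z̄)^w dt`, `C_k = -(2i)^{k-1}`). Here, for two cusp functions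
`φ, ψ` (`IsCuspFunction`: periodic, holomorphic, vanishing at `i∞` — e.g. `f ∣ A`, `g ∣ A`) and
`w = n`:

* `F(z) = eichlerKernel n φ z (z̄, 1)` (the tree's Eichler–Shimura kernel
  `∫_z^{i∞} φ(t)(t v - u)ⁿ dt` of `EichlerShimuraPeriods` at `(u, v) = (z̄, 1)`), and the integrand
  `P = F ψ̄` is real-`C¹` on the upper half-plane: `HaberlandStokes.hasFDerivAt_integrand`
  (`D(F ψ̄) = a • id + b • conj`, from `d/dz ∫_z^{i∞} φ tʲ = -φ zʲ` and the expansion of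
  `(t - z̄)ⁿ`), with `a = ∂P/∂z = -φ ψ̄ (z - z̄)ⁿ` (`HaberlandStokes.a_eq`) and hence the Stokes
  integrand `-i∂P/∂x - ∂P/∂y = -2i ∂P/∂z = (2i)ⁿ⁺¹ yⁿ φ ψ̄` (`HaberlandStokes.stokes_integrand_eq`);
* exponential decay of `P` and `DP` at `i∞`, uniformly on vertical strips
  (`HaberlandStokes.exists_norm_integrand_le`, `HaberlandStokes.exists_norm_fderiv_integrand_le`;
  inputs: the `q`-expansion bound of a cusp function based at height `1/2`
  (`HaberlandStokes.exists_norm_apply_le`), Cauchy's estimate for its derivative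
  (`HaberlandStokes.exists_norm_deriv_le`), the tree's bounds for `∫_z^{i∞} φ tʲ`, and a
  compactness argument to come down to height `1/2 < √3/2`, `HaberlandStokes.exists_bound_of_bound_ge`);
* **`HaberlandStokes.stokes_fd`** — Green's theorem (`green_dzbar` of
  `GreenVerticallySimpleProofs`) on `𝔉 = {|x| ≤ 1/2, y ≥ √(1 - x²)}`:
  `(2i)ⁿ⁺¹ ∫_{-1/2}^{1/2} ∫_{√(1-x²)}^∞ yⁿ φ ψ̄ dy dx
     = ∫_{-1/2}^{1/2} P(x + i√(1-x²)) (1 + i x/√(1-x²)) dx - i∫_{√3/2}^∞ P(½ + it) dt + i∫_{√3/2}^∞ P(-½ + it) dt`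
  (bottom arc left to right, right side up, left side down), i.e. `∮_{∂𝔉} P dz̄`.

The summation over cosets, the cancellation of the vertical sides and the `S`-symmetrisation of
the arc (the rest of PP §8.2) are the next brick.

## References

* [PasolPopa2013] V. Paşol, A. A. Popa, Proc. LMS 107 (2013) 713–743, arXiv:1202.5802: Thm. 3.2,
  §8.2 (proof of Thm. 8.6).
* [KohnenZagier1984] W. Kohnen, D. Zagier, *Modular forms with rational periods*, in: Modular
  forms (Durham, 1983), 197–249: p. 243 (Haberland's formula by Stokes' theorem on `𝔉`).
-/

noncomputable section

open MeasureTheory Set Filter Topology Complex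
open scoped ComplexConjugate UpperHalfPlane

namespace Literature.NumberTheory.EllipticCurves.ModularForms

namespace HaberlandStokes

/-! ### Calculus: real derivative of `u · conj v` for holomorphic `u, v` -/

/-- The real-linear map `h ↦ a h + b h̄` on `ℂ`. [folklore] -/
theorem clm_apply (a b h : ℂ) :
    (a • ContinuousLinearMap.id ℝ ℂ + b • (conjCLE : ℂ →L[ℝ] ℂ)) h = a * h + b * conj h := by
  simp

/-- Operator norm of `h ↦ a h + b h̄`: at most `‖a‖ + ‖b‖`. [folklore] -/
theorem norm_clm_le (a b : ℂ) :
    ‖a • ContinuousLinearMap.id ℝ ℂ + b • (conjCLE : ℂ →L[ℝ] ℂ)‖ ≤ ‖a‖ + ‖b‖ := by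
  refine ContinuousLinearMap.opNorm_le_bound _ (by positivity) fun h ↦ ?_
  rw [clm_apply]
  calc ‖a * h + b * conj h‖ ≤ ‖a * h‖ + ‖b * conj h‖ := norm_add_le _ _
    _ = (‖a‖ + ‖b‖) * ‖h‖ := by rw [norm_mul, norm_mul, Complex.norm_conj]; ring

/-- **Real derivative of `u · \overline{v}`** for complex-differentiable `u, v`:
`D(u v̄)(z) h = (u'(z) \overline{v(z)}) h + (u(z) \overline{v'(z)}) h̄`. [folklore] -/
theorem hasFDerivAt_mul_conj {u v : ℂ → ℂ} {u' v' z : ℂ} (hu : HasDerivAt u u' z)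
    (hv : HasDerivAt v v' z) :
    HasFDerivAt (fun w ↦ u w * conj (v w))
      ((conj (v z) * u') • ContinuousLinearMap.id ℝ ℂ + (u z * conj v') • (conjCLE : ℂ →L[ℝ] ℂ)) z := by
  have hu' : HasFDerivAt u ((ContinuousLinearMap.toSpanSingleton ℂ u').restrictScalars ℝ) z :=
    hu.hasFDerivAt.restrictScalars ℝ
  have hv' : HasFDerivAt v ((ContinuousLinearMap.toSpanSingleton ℂ v').restrictScalars ℝ) z :=
    hv.hasFDerivAt.restrictScalars ℝ
  have hcv : HasFDerivAt (fun w ↦ conj (v w))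
      ((conjCLE : ℂ →L[ℝ] ℂ).comp ((ContinuousLinearMap.toSpanSingleton ℂ v').restrictScalars ℝ)) z :=
    conjCLE.hasFDerivAt.comp z hv'
  have H := hu'.mul hcv
  refine H.congr_fderiv ?_
  ext h
  simp [ContinuousLinearMap.toSpanSingleton_apply]
  ring

/-- Continuity of `z ↦ a(z) • id + b(z) • conj` from that of `a, b`. [folklore] -/
theorem continuousOn_clm {a b : ℂ → ℂ} {s : Set ℂ} (ha : ContinuousOn a s) (hb : ContinuousOn b s) :
    ContinuousOn (fun z ↦ a z • ContinuousLinearMap.id ℝ ℂ + b z • (conjCLE : ℂ →L[ℝ] ℂ)) s :=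
  (ha.smul continuousOn_const).add (hb.smul continuousOn_const)

/-! ### Elementary bounds -/

/-- A continuous function on `[0, ∞)` tending to `0` at `∞` is bounded above there. [folklore] -/
theorem exists_bound_of_tendsto_zero {g : ℝ → ℝ} (hg : ContinuousOn g (Ici 0))
    (hlim : Tendsto g atTop (𝓝 0)) : ∃ M : ℝ, ∀ y, 0 ≤ y → g y ≤ M := by
  obtain ⟨Y, hY⟩ := (hlim.eventually (ge_mem_nhds zero_lt_one)).exists_forall_of_atTop
  obtain ⟨M₀, hM₀⟩ := isCompact_Icc.exists_bound_of_continuousOn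
    (hg.mono (Icc_subset_Ici_self : Icc (0 : ℝ) (max Y 0) ⊆ Ici 0))
  refine ⟨max M₀ 1, fun y hy ↦ ?_⟩
  by_cases h : y ≤ max Y 0
  · exact ((le_abs_self _).trans (by simpa [Real.norm_eq_abs] using hM₀ y ⟨hy, h⟩)).trans (le_max_left _ _)
  · push Not at h
    exact (hY y ((le_max_left _ _).trans h.le)).trans (le_max_right _ _)

/-- `(A + B y)ⁿ e^{-a y} ≤ M` for `y ≥ 0` (`a > 0`). [folklore] -/
theorem exists_affine_pow_mul_exp_le (A B : ℝ) (n : ℕ) {a : ℝ} (ha : 0 < a) :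
    ∃ M : ℝ, ∀ y, 0 ≤ y → (A + B * y) ^ n * Real.exp (-a * y) ≤ M :=
  exists_bound_of_tendsto_zero (by fun_prop) (tendsto_affine_pow_mul_exp_neg_atTop A B n ha)

/-- **Extending an exponential bound down to height `m`** by compactness: if `Q` is continuous on
the upper half-plane and `‖Q z‖ ≤ C e^{-c y}` on `[a, b] × [Y, ∞)`, then the same kind of bound
holds on `[a, b] × [m, ∞)` for every `0 < m`. [folklore] -/
theorem exists_bound_of_bound_ge {E : Type*} [NormedAddCommGroup E] {Q : ℂ → E}
    (hQ : ContinuousOn Q {z : ℂ | 0 < z.im}) {a b Y m C c : ℝ} (hm : 0 < m)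
    (hb : ∀ z : ℂ, z.re ∈ Icc a b → Y ≤ z.im → ‖Q z‖ ≤ C * Real.exp (-c * z.im)) :
    ∃ C' : ℝ, 0 ≤ C' ∧ ∀ z : ℂ, z.re ∈ Icc a b → m ≤ z.im → ‖Q z‖ ≤ C' * Real.exp (-c * z.im) := by
  -- the compact box `[a, b] × [m, Y]`
  have hK : IsCompact (Icc a b ×ℂ Icc m Y) := isCompact_Icc.reProdIm isCompact_Icc
  have hKsub : Icc a b ×ℂ Icc m Y ⊆ {z : ℂ | 0 < z.im} := fun z hz ↦ hm.trans_le hz.2.1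
  obtain ⟨M, hM⟩ := hK.exists_bound_of_continuousOn (hQ.mono hKsub)
  have hM0 : 0 ≤ max M 0 := le_max_right _ _
  -- on the box, `e^{-c y} ≥ e^{-|c| (|m| + |Y|)}`-type lower bound: use `exp(-c y) ≥ exp (-(|c| * (|m|+|Y|)))`
  set L : ℝ := Real.exp (|c| * (|m| + |Y|)) with hL
  refine ⟨max C 0 + max M 0 * L, by positivity, fun z hre him ↦ ?_⟩
  by_cases hY : Y ≤ z.im
  · calc ‖Q z‖ ≤ C * Real.exp (-c * z.im) := hb z hre hY
      _ ≤ (max C 0 + max M 0 * L) * Real.exp (-c * z.im) := by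
          gcongr
          calc C ≤ max C 0 := le_max_left _ _
            _ ≤ max C 0 + max M 0 * L := le_add_of_nonneg_right (by positivity)
  · push Not at hY
    have hzK : z ∈ Icc a b ×ℂ Icc m Y := ⟨hre, him, hY.le⟩
    have h1 : ‖Q z‖ ≤ max M 0 := (hM z hzK).trans (le_max_left _ _)
    -- `1 ≤ L * exp(-c * im z)` on the box
    have h2 : 1 ≤ L * Real.exp (-c * z.im) := by
      rw [hL, ← Real.exp_add]
      apply Real.one_le_exp
      have : -c * z.im ≥ -(|c| * (|m| + |Y|)) := by
        have hzabs : |z.im| ≤ |m| + |Y| := by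
          rw [abs_le]
          constructor
          · have := abs_nonneg m; have := abs_nonneg Y; have := hm.le.trans him; linarith
          · exact (le_abs_self _).trans ((abs_le_abs hY.le (by linarith [hm.le.trans him])).trans
              (le_add_of_nonneg_left (abs_nonneg m)))
        have h3 : |c * z.im| ≤ |c| * (|m| + |Y|) := by
          rw [abs_mul]; exact mul_le_mul_of_nonneg_left hzabs (abs_nonneg c)
        have h4 := le_abs_self (c * z.im)
        have h5 : -c * z.im = -(c * z.im) := by ring
        linarith
      linarith
    calc ‖Q z‖ ≤ max M 0 * 1 := by rw [mul_one]; exact h1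
      _ ≤ max M 0 * (L * Real.exp (-c * z.im)) := by gcongr
      _ = (max M 0 * L) * Real.exp (-c * z.im) := by ring
      _ ≤ (max C 0 + max M 0 * L) * Real.exp (-c * z.im) := by
          gcongr; exact le_add_of_nonneg_left (le_max_right _ _)

/-! ### Bounds for cusp functions and their derivatives -/

open UpperHalfPlane hiding I in
/-- **Uniform exponential decay of a cusp function**: `‖φ(z)‖ ≤ C e^{-2π y/h}` for `im z > 1/2`
(the `q`-expansion, based at height `1/2`). [folklore] -/
theorem exists_norm_apply_le {h : ℝ} {φ : ℍ → ℂ} (hφ : IsCuspFunction h φ) :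
    ∃ C : ℝ, 0 ≤ C ∧ ∀ z : ℂ, 1 / 2 < z.im →
      ‖φ (ofComplex z)‖ ≤ C * Real.exp (-(2 * Real.pi / h) * z.im) := by
  have hh := hφ.pos
  set r : ℝ := Real.exp (-(2 * Real.pi / h) * (1 / 2)) with hr
  set A : ℝ := ∑' m : ℕ, ‖(qExpansion h φ).coeff m‖ * r ^ m with hA
  have hA0 : 0 ≤ A := tsum_nonneg fun m ↦ by positivity
  refine ⟨A * Real.exp ((2 * Real.pi / h) * (1 / 2)), by positivity, fun z hz ↦ ?_⟩
  -- base point `x + i/2`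
  set τ : ℍ := ⟨(z.re : ℂ) + (1 / 2 : ℝ) * Complex.I, by simp⟩ with hτ
  have hτim : τ.im = 1 / 2 := by
    change ((z.re : ℂ) + (1 / 2 : ℝ) * Complex.I).im = 1 / 2
    simp
  have hq : ‖Function.Periodic.qParam h (τ : ℂ)‖ = r := by
    rw [Function.Periodic.norm_qParam, UpperHalfPlane.coe_im, hτim, hr]
    congr 1
    ring
  have hpt : ((τ : ℂ) + ((z.im - 1 / 2 : ℝ) : ℂ) * Complex.I) = z := by
    change (z.re : ℂ) + (1 / 2 : ℝ) * Complex.I + ((z.im - 1 / 2 : ℝ) : ℂ) * Complex.I = z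
    conv_rhs => rw [← Complex.re_add_im z]
    push_cast
    ring
  have H := hφ.norm_ray_le τ (t := z.im - 1 / 2) (by linarith)
  rw [hpt] at H
  simp_rw [hq] at H
  refine H.trans (le_of_eq ?_)
  rw [mul_assoc, ← Real.exp_add]
  congr 1
  ring_nf

open UpperHalfPlane hiding I in
/-- A cusp function is complex-differentiable on the open upper half-plane (as a function on `ℂ`). [folklore] -/
theorem differentiableOn_comp_ofComplex {h : ℝ} {φ : ℍ → ℂ} (hφ : IsCuspFunction h φ) :
    DifferentiableOn ℂ (φ ∘ ofComplex) {z : ℂ | 0 < z.im} :=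
  UpperHalfPlane.mdifferentiable_iff.mp hφ.mdifferentiable

open UpperHalfPlane hiding I in
/-- The derivative of a cusp function exists on the upper half-plane. [folklore] -/
theorem hasDerivAt_comp_ofComplex {h : ℝ} {φ : ℍ → ℂ} (hφ : IsCuspFunction h φ) {z : ℂ}
    (hz : 0 < z.im) : HasDerivAt (φ ∘ ofComplex) (deriv (φ ∘ ofComplex) z) z :=
  (((differentiableOn_comp_ofComplex hφ).differentiableAt
    ((isOpen_lt continuous_const Complex.continuous_im).mem_nhds hz))).hasDerivAt

open UpperHalfPlane hiding I in
/-- The derivative of a cusp function is continuous on the upper half-plane. [folklore] -/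
theorem continuousOn_deriv_comp_ofComplex {h : ℝ} {φ : ℍ → ℂ} (hφ : IsCuspFunction h φ) :
    ContinuousOn (deriv (φ ∘ ofComplex)) {z : ℂ | 0 < z.im} :=
  ((differentiableOn_comp_ofComplex hφ).contDiffOn (n := 1)
    (isOpen_lt continuous_const Complex.continuous_im)).continuousOn_deriv_of_isOpen
    (isOpen_lt continuous_const Complex.continuous_im) le_rfl

open UpperHalfPlane hiding I in
/-- **Exponential decay of the derivative of a cusp function**: `‖φ'(z)‖ ≤ C e^{-2πy/h}` for
`im z ≥ 2` (Cauchy's estimate on the disc of radius `1`). [folklore] -/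
theorem exists_norm_deriv_le {h : ℝ} {φ : ℍ → ℂ} (hφ : IsCuspFunction h φ) :
    ∃ C : ℝ, 0 ≤ C ∧ ∀ z : ℂ, 2 ≤ z.im →
      ‖deriv (φ ∘ ofComplex) z‖ ≤ C * Real.exp (-(2 * Real.pi / h) * z.im) := by
  have hh := hφ.pos
  obtain ⟨C₀, hC₀, hb⟩ := exists_norm_apply_le hφ
  refine ⟨C₀ * Real.exp (2 * Real.pi / h), by positivity, fun z hz ↦ ?_⟩
  have him_ball : ∀ w ∈ Metric.closedBall z 1, z.im - 1 ≤ w.im := by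
    intro w hw
    have h1 : |(w - z).im| ≤ ‖w - z‖ := Complex.abs_im_le_norm _
    rw [Metric.mem_closedBall, dist_eq_norm] at hw
    have := abs_le.mp (h1.trans hw)
    simp only [Complex.sub_im] at this
    linarith
  have hdiff : DiffContOnCl ℂ (φ ∘ ofComplex) (Metric.ball z 1) := by
    refine DifferentiableOn.diffContOnCl ?_
    rw [closure_ball z one_ne_zero]
    exact (differentiableOn_comp_ofComplex hφ).mono fun w hw ↦ by
      have := him_ball w hw
      simp only [mem_setOf_eq]
      linarith
  have hsph : ∀ w ∈ Metric.sphere z 1, ‖(φ ∘ ofComplex) w‖ ≤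
      C₀ * Real.exp (2 * Real.pi / h) * Real.exp (-(2 * Real.pi / h) * z.im) := by
    intro w hw
    have hw' := him_ball w (Metric.sphere_subset_closedBall hw)
    have h1 := hb w (by linarith)
    refine h1.trans ?_
    rw [mul_assoc, ← Real.exp_add]
    gcongr
    · have hc : 0 < 2 * Real.pi / h := by positivity
      have := mul_le_mul_of_nonneg_left hw' hc.le
      linarith
  have := Complex.norm_deriv_le_of_forall_mem_sphere_norm_le one_pos hdiff hsph
  simpa using this

/-! ### The integrand `P(z) = F(z) \overline{ψ(z)}`, `F(z) = ∫_z^{i∞} φ(t)(t - z̄)ⁿ dt` -/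

section Integrand

open UpperHalfPlane hiding I

variable {n : ℕ} {h₁ h₂ : ℝ} {φ ψ : ℍ → ℂ}

/-- `F(z) \overline{ψ(z)} = ∑ⱼ uⱼ(z) \overline{vⱼ(z)}` with `uⱼ = C(n,j) ∫_z^{i∞} φ tʲ dt` and
`vⱼ(z) = (-z)ⁿ⁻ʲ ψ(z)` (expansion of `(t - z̄)ⁿ`). [folklore] -/
theorem integrand_eq_sum (n : ℕ) (φ ψ : ℍ → ℂ) (w : ℂ) :
    eichlerKernel n φ (ofComplex w) ![conj w, 1] * conj (ψ (ofComplex w)) =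
      ∑ j ∈ Finset.range (n + 1), ((n.choose j : ℂ) * powPrimitive j φ (ofComplex w)) *
        conj ((-w) ^ (n - j) * ψ (ofComplex w)) := by
  simp only [eichlerKernel, Finset.sum_mul, Matrix.cons_val_one, Matrix.cons_val_zero, one_pow,
    mul_one, map_mul, map_pow, map_neg]
  refine Finset.sum_congr rfl fun j _ ↦ ?_
  ring

/-- Derivative of `vⱼ(z) = (-z)ⁿ⁻ʲ ψ(z)`. [folklore] -/
theorem hasDerivAt_v (hψ : IsCuspFunction h₂ ψ) (k : ℕ) {z : ℂ} (hz : 0 < z.im) :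
    HasDerivAt (fun w : ℂ ↦ (-w) ^ k * ψ (ofComplex w))
      ((k : ℂ) * (-z) ^ (k - 1) * (-1) * ψ (ofComplex z) + (-z) ^ k * deriv (ψ ∘ ofComplex) z) z := by
  have h1 : HasDerivAt (fun w : ℂ ↦ (-w) ^ k) ((k : ℂ) * (-z) ^ (k - 1) * (-1)) z :=
    (hasDerivAt_neg z).pow k
  have h2 := hasDerivAt_comp_ofComplex hψ hz
  have e : (fun w : ℂ ↦ (-w) ^ k * ψ (ofComplex w)) = (fun w : ℂ ↦ (-w) ^ k) * (ψ ∘ ofComplex) := rfl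
  rw [e]
  refine (h1.mul h2).congr_deriv ?_
  simp only [Function.comp_apply]

/-- **Real differentiability of the integrand**: for `im z > 0`,
`D(F ψ̄)(z) = a(z) • id + b(z) • conj` with
`a = ∑ⱼ \overline{vⱼ} uⱼ'` (`uⱼ' = -C(n,j) φ zʲ`) and `b = ∑ⱼ uⱼ \overline{vⱼ'}`. [folklore] -/
theorem hasFDerivAt_integrand (hφ : IsCuspFunction h₁ φ) (hψ : IsCuspFunction h₂ ψ) {z : ℂ}
    (hz : 0 < z.im) :
    HasFDerivAt (fun w : ℂ ↦ eichlerKernel n φ (ofComplex w) ![conj w, 1] * conj (ψ (ofComplex w)))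
      ((∑ j ∈ Finset.range (n + 1), conj ((-z) ^ (n - j) * ψ (ofComplex z)) *
          ((n.choose j : ℂ) * (-(φ (ofComplex z) * z ^ j)))) • ContinuousLinearMap.id ℝ ℂ +
        (∑ j ∈ Finset.range (n + 1), ((n.choose j : ℂ) * powPrimitive j φ (ofComplex z)) *
          conj (((n - j : ℕ) : ℂ) * (-z) ^ (n - j - 1) * (-1) * ψ (ofComplex z) +
            (-z) ^ (n - j) * deriv (ψ ∘ ofComplex) z)) • (conjCLE : ℂ →L[ℝ] ℂ)) z := by
  have hfun : (fun w : ℂ ↦ eichlerKernel n φ (ofComplex w) ![conj w, 1] * conj (ψ (ofComplex w))) =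
      fun w ↦ ∑ j ∈ Finset.range (n + 1), ((n.choose j : ℂ) * powPrimitive j φ (ofComplex w)) *
        conj ((-w) ^ (n - j) * ψ (ofComplex w)) := by
    funext w
    exact integrand_eq_sum n φ ψ w
  rw [hfun]
  have hu : ∀ j, HasDerivAt (fun w : ℂ ↦ (n.choose j : ℂ) * powPrimitive j φ (ofComplex w))
      ((n.choose j : ℂ) * (-(φ (ofComplex z) * z ^ j))) z := fun j ↦
    (hφ.hasDerivAt_powPrimitive j hz).const_mul _
  refine (HasFDerivAt.fun_sum fun j _ ↦
    hasFDerivAt_mul_conj (hu j) (hasDerivAt_v hψ (n - j) hz)).congr_fderiv ?_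
  rw [ContinuousLinearMap.ext_iff]
  intro w
  simp [Finset.sum_add_distrib, Finset.sum_mul]

/-- **`∑ⱼ \overline{vⱼ} uⱼ' = -φ(z) \overline{ψ(z)} (z - z̄)ⁿ = ∂(F ψ̄)/∂z`** (binomial theorem). [folklore] -/
theorem a_eq (n : ℕ) (φ ψ : ℍ → ℂ) (z : ℂ) :
    ∑ j ∈ Finset.range (n + 1), conj ((-z) ^ (n - j) * ψ (ofComplex z)) *
        ((n.choose j : ℂ) * (-(φ (ofComplex z) * z ^ j))) =
      -(φ (ofComplex z) * conj (ψ (ofComplex z)) * (z - conj z) ^ n) := by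
  rw [sub_eq_add_neg, add_pow, Finset.mul_sum, ← Finset.sum_neg_distrib]
  refine Finset.sum_congr rfl fun j _ ↦ ?_
  simp only [map_mul, map_pow, map_neg]
  ring

/-- **The Stokes integrand**: `-i ∂P/∂x - ∂P/∂y = -2i ∂P/∂z = (2i)ⁿ⁺¹ yⁿ φ(z) \overline{ψ(z)}` for
`P = F ψ̄`. [folklore] -/
theorem stokes_integrand_eq (n : ℕ) (φ ψ : ℍ → ℂ) (z a b : ℂ)
    (ha : a = -(φ (ofComplex z) * conj (ψ (ofComplex z)) * (z - conj z) ^ n)) :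
    -I * (a • ContinuousLinearMap.id ℝ ℂ + b • (conjCLE : ℂ →L[ℝ] ℂ)) 1 -
        (a • ContinuousLinearMap.id ℝ ℂ + b • (conjCLE : ℂ →L[ℝ] ℂ)) I =
      (2 * I) ^ (n + 1) * (z.im : ℂ) ^ n * (φ (ofComplex z) * conj (ψ (ofComplex z))) := by
  simp only [clm_apply, map_one, Complex.conj_I, mul_one, mul_neg]
  rw [ha, Complex.sub_conj]
  push_cast
  ring

end Integrand

/-! ### Continuity of the derivative field -/

section Continuity

open UpperHalfPlane hiding I

variable {n : ℕ} {h₁ h₂ : ℝ} {φ ψ : ℍ → ℂ}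

/-- `z ↦ ∫_z^{i∞} φ tʲ dt` is continuous on the upper half-plane. [folklore] -/
theorem continuousOn_powPrimitive (hφ : IsCuspFunction h₁ φ) (j : ℕ) :
    ContinuousOn (fun w : ℂ ↦ powPrimitive j φ (ofComplex w)) {z : ℂ | 0 < z.im} :=
  fun _ hz ↦ (hφ.hasDerivAt_powPrimitive j hz).continuousAt.continuousWithinAt

/-- A cusp function is continuous on the upper half-plane (as a function on `ℂ`). [folklore] -/
theorem continuousOn_apply (hφ : IsCuspFunction h₁ φ) :
    ContinuousOn (fun w : ℂ ↦ φ (ofComplex w)) {z : ℂ | 0 < z.im} :=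
  hφ.continuousOn_comp_ofComplex

/-- **Continuity of the derivative field `D(F ψ̄)`** on the upper half-plane. [folklore] -/
theorem continuousOn_fderiv_integrand (hφ : IsCuspFunction h₁ φ) (hψ : IsCuspFunction h₂ ψ) :
    ContinuousOn (fun z : ℂ ↦
      (∑ j ∈ Finset.range (n + 1), conj ((-z) ^ (n - j) * ψ (ofComplex z)) *
          ((n.choose j : ℂ) * (-(φ (ofComplex z) * z ^ j)))) • ContinuousLinearMap.id ℝ ℂ +
        (∑ j ∈ Finset.range (n + 1), ((n.choose j : ℂ) * powPrimitive j φ (ofComplex z)) *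
          conj (((n - j : ℕ) : ℂ) * (-z) ^ (n - j - 1) * (-1) * ψ (ofComplex z) +
            (-z) ^ (n - j) * deriv (ψ ∘ ofComplex) z)) • (conjCLE : ℂ →L[ℝ] ℂ)) {z : ℂ | 0 < z.im} := by
  have hφc := continuousOn_apply hφ
  have hψc := continuousOn_apply hψ
  have hψ'c := continuousOn_deriv_comp_ofComplex hψ
  have hconj : Continuous (fun w : ℂ ↦ conj w) := Complex.continuous_conj
  refine continuousOn_clm ?_ ?_
  · refine continuousOn_finsetSum _ fun j _ ↦ ?_
    refine ContinuousOn.mul (hconj.comp_continuousOn ((by fun_prop : Continuous fun z : ℂ ↦ (-z) ^ (n - j)).continuousOn.mul hψc)) ?_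
    exact continuousOn_const.mul ((hφc.mul (by fun_prop : Continuous fun z : ℂ ↦ z ^ j).continuousOn).neg)
  · refine continuousOn_finsetSum _ fun j _ ↦ ?_
    refine (continuousOn_const.mul (continuousOn_powPrimitive hφ j)).mul (hconj.comp_continuousOn ?_)
    refine ContinuousOn.add ?_ ?_
    · exact ((by fun_prop : Continuous fun z : ℂ ↦ ((n - j : ℕ) : ℂ) * (-z) ^ (n - j - 1) * (-1)).continuousOn).mul hψc
    · exact ((by fun_prop : Continuous fun z : ℂ ↦ (-z) ^ (n - j)).continuousOn).mul hψ'c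

end Continuity

/-! ### Exponential bounds at `i∞` -/

section Bounds

open UpperHalfPlane hiding I

variable {n : ℕ} {h₁ h₂ : ℝ} {φ ψ : ℍ → ℂ}

/-- `‖z‖ ≤ 1 + 2R + 2 im z` when `|re z| ≤ R`, `im z ≥ 0`; this quantity is `≥ 1`
and `≥ 1 + |re z| + im z`. [folklore] -/
theorem norm_le_B {z : ℂ} {R : ℝ} (hre : |z.re| ≤ R) (him : 0 ≤ z.im) :
    ‖z‖ ≤ 1 + 2 * R + 2 * z.im ∧ 1 ≤ 1 + 2 * R + 2 * z.im ∧
      1 + |z.re| + z.im ≤ 1 + 2 * R + 2 * z.im := by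
  have h1 : ‖z‖ ≤ |z.re| + |z.im| := Complex.norm_le_abs_re_add_abs_im z
  rw [abs_of_nonneg him] at h1
  have hR : 0 ≤ R := (abs_nonneg _).trans hre
  exact ⟨by linarith, by linarith, by linarith⟩

/-- **Decay of the integrand**: `‖F(z) \overline{ψ(z)}‖ ≤ C e^{-(2π/h₂) y}` for `|re z| ≤ R`,
`im z ≥ 1`. [folklore] -/
theorem exists_norm_integrand_le (hφ : IsCuspFunction h₁ φ) (hψ : IsCuspFunction h₂ ψ) (n : ℕ) (R : ℝ) :
    ∃ C : ℝ, 0 ≤ C ∧ ∀ z : ℂ, |z.re| ≤ R → 1 ≤ z.im →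
      ‖eichlerKernel n φ (ofComplex z) ![conj z, 1] * conj (ψ (ofComplex z))‖ ≤
        C * Real.exp (-(2 * Real.pi / h₂) * z.im) := by
  have hh₁ := hφ.pos
  obtain ⟨Ck, hCk0, hCk⟩ := hφ.exists_norm_eichlerKernel_le (n := n)
  obtain ⟨Cψ, hCψ0, hCψ⟩ := exists_norm_apply_le hψ
  obtain ⟨M, hM⟩ := exists_affine_pow_mul_exp_le (1 + 2 * R) 2 n (a := 2 * Real.pi / h₁) (by positivity)
  set M₀ : ℝ := max M 0 with hM₀
  have hM00 : 0 ≤ M₀ := le_max_right _ _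
  refine ⟨Ck * Cψ * (M₀ * 2 ^ n), by positivity, fun z hre him ↦ ?_⟩
  have him0 : 0 < z.im := by linarith
  set τ : ℍ := ofComplex z with hτ
  have hτim : τ.im = z.im := by rw [hτ, ← UpperHalfPlane.coe_im, ofComplex_apply_of_im_pos him0]
  have hτre : τ.re = z.re := by rw [hτ, ← UpperHalfPlane.coe_re, ofComplex_apply_of_im_pos him0]
  obtain ⟨hzB, hB1, hB2⟩ := norm_le_B hre him0.le
  set B : ℝ := 1 + 2 * R + 2 * z.im with hB
  have hk := hCk τ ![conj z, 1] (by rw [hτim]; exact him)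
  simp only [Matrix.cons_val_one, Matrix.cons_val_zero, norm_one, mul_one, Complex.norm_conj,
    hτim, hτre] at hk
  have hbase : (1 + |z.re| + z.im + ‖z‖) ^ n ≤ (B + B) ^ n := by
    apply pow_le_pow_left₀ (by positivity)
    linarith
  have hk' : ‖eichlerKernel n φ τ ![conj z, 1]‖ ≤
      Ck * (B + B) ^ n * Real.exp (-(2 * Real.pi / h₁) * z.im) := by
    refine hk.trans ?_
    gcongr
  have hψz := hCψ z (by linarith)
  have hMz : (B + B) ^ n * Real.exp (-(2 * Real.pi / h₁) * z.im) ≤ M₀ * 2 ^ n := by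
    have h1 : (1 + 2 * R + 2 * z.im) ^ n * Real.exp (-(2 * Real.pi / h₁) * z.im) ≤ M₀ :=
      (hM z.im him0.le).trans (le_max_left _ _)
    have e : (B + B) ^ n = 2 ^ n * (1 + 2 * R + 2 * z.im) ^ n := by rw [hB, ← two_mul, mul_pow]
    rw [e, mul_assoc]
    calc 2 ^ n * ((1 + 2 * R + 2 * z.im) ^ n * Real.exp (-(2 * Real.pi / h₁) * z.im))
        ≤ 2 ^ n * M₀ := by gcongr
      _ = M₀ * 2 ^ n := by ring
  rw [norm_mul, Complex.norm_conj]
  calc ‖eichlerKernel n φ τ ![conj z, 1]‖ * ‖ψ (ofComplex z)‖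
      ≤ (Ck * (B + B) ^ n * Real.exp (-(2 * Real.pi / h₁) * z.im)) *
          (Cψ * Real.exp (-(2 * Real.pi / h₂) * z.im)) :=
        mul_le_mul hk' hψz (norm_nonneg _) (by positivity)
    _ = Ck * Cψ * ((B + B) ^ n * Real.exp (-(2 * Real.pi / h₁) * z.im)) *
          Real.exp (-(2 * Real.pi / h₂) * z.im) := by ring
    _ ≤ Ck * Cψ * (M₀ * 2 ^ n) * Real.exp (-(2 * Real.pi / h₂) * z.im) := by gcongr

/-- **Decay of the derivative field**: `‖D(F ψ̄)(z)‖ ≤ C e^{-(2π/h₂) y}` for `|re z| ≤ R`,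
`im z ≥ 2`. [folklore] -/
theorem exists_norm_fderiv_integrand_le (hφ : IsCuspFunction h₁ φ) (hψ : IsCuspFunction h₂ ψ)
    (n : ℕ) (R : ℝ) :
    ∃ C : ℝ, 0 ≤ C ∧ ∀ z : ℂ, |z.re| ≤ R → 2 ≤ z.im →
      ‖(∑ j ∈ Finset.range (n + 1), conj ((-z) ^ (n - j) * ψ (ofComplex z)) *
          ((n.choose j : ℂ) * (-(φ (ofComplex z) * z ^ j)))) • ContinuousLinearMap.id ℝ ℂ +
        (∑ j ∈ Finset.range (n + 1), ((n.choose j : ℂ) * powPrimitive j φ (ofComplex z)) *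
          conj (((n - j : ℕ) : ℂ) * (-z) ^ (n - j - 1) * (-1) * ψ (ofComplex z) +
            (-z) ^ (n - j) * deriv (ψ ∘ ofComplex) z)) • (conjCLE : ℂ →L[ℝ] ℂ)‖ ≤
        C * Real.exp (-(2 * Real.pi / h₂) * z.im) := by
  have hh₁ := hφ.pos
  have hh₂ := hψ.pos
  choose Cp hCp0 hCp using fun j ↦ IsCuspFunction.exists_norm_powPrimitive_le (h := h₁) j hφ
  obtain ⟨Cφ, hCφ0, hCφ⟩ := exists_norm_apply_le hφ
  obtain ⟨Cψ, hCψ0, hCψ⟩ := exists_norm_apply_le hψ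
  obtain ⟨Cψ', hCψ'0, hCψ'⟩ := exists_norm_deriv_le hψ
  have hc₁ : 0 < 2 * Real.pi / h₁ := by positivity
  obtain ⟨Ma, hMa⟩ := exists_affine_pow_mul_exp_le 0 2 n hc₁
  obtain ⟨Mb, hMb⟩ := exists_affine_pow_mul_exp_le (1 + 2 * R) 2 (n + n) hc₁
  set Ma₀ : ℝ := max Ma 0
  set Mb₀ : ℝ := max Mb 0
  have hMa0 : 0 ≤ Ma₀ := le_max_right _ _
  have hMb0 : 0 ≤ Mb₀ := le_max_right _ _
  set K : ℝ := ∑ j ∈ Finset.range (n + 1), (n.choose j : ℝ) * Cp j with hK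
  have hK0 : 0 ≤ K := Finset.sum_nonneg fun j _ ↦ by have := hCp0 j; positivity
  refine ⟨Cφ * Cψ * Ma₀ + K * (n * Cψ + Cψ') * Mb₀, by positivity, fun z hre him ↦ ?_⟩
  have him0 : 0 < z.im := by linarith
  set y : ℝ := z.im with hy
  set E₁ : ℝ := Real.exp (-(2 * Real.pi / h₁) * y)
  set E₂ : ℝ := Real.exp (-(2 * Real.pi / h₂) * y)
  have hE₁ : 0 ≤ E₁ := (Real.exp_pos _).le
  have hE₂ : 0 ≤ E₂ := (Real.exp_pos _).le
  obtain ⟨hzB, hB1, hB2⟩ := norm_le_B hre him0.le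
  set B : ℝ := 1 + 2 * R + 2 * y with hB
  have hB0 : 0 ≤ B := zero_le_one.trans hB1
  set τ : ℍ := ofComplex z with hτ
  have hτim : τ.im = y := by rw [hτ, ← UpperHalfPlane.coe_im, ofComplex_apply_of_im_pos him0]
  have hτre : τ.re = z.re := by rw [hτ, ← UpperHalfPlane.coe_re, ofComplex_apply_of_im_pos him0]
  have hφz : ‖φ (ofComplex z)‖ ≤ Cφ * E₁ := hCφ z (by linarith)
  have hψz : ‖ψ (ofComplex z)‖ ≤ Cψ * E₂ := hCψ z (by linarith)
  have hψ'z : ‖deriv (ψ ∘ ofComplex) z‖ ≤ Cψ' * E₂ := hCψ' z him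
  -- powers of `‖z‖` against `B`
  have hzpow : ∀ m, m ≤ n → ‖z‖ ^ m ≤ B ^ n := fun m hm ↦
    (pow_le_pow_left₀ (norm_nonneg _) hzB m).trans (pow_le_pow_right₀ hB1 hm)
  -- Step a: `‖a z‖ ≤ Cφ Cψ Ma₀ E₂`
  have ha : ‖∑ j ∈ Finset.range (n + 1), conj ((-z) ^ (n - j) * ψ (ofComplex z)) *
      ((n.choose j : ℂ) * (-(φ (ofComplex z) * z ^ j)))‖ ≤ Cφ * Cψ * Ma₀ * E₂ := by
    have hzc : ‖z - conj z‖ = 2 * y := by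
      rw [Complex.sub_conj, norm_mul, Complex.norm_I, mul_one, Complex.norm_real, Real.norm_eq_abs,
        abs_of_nonneg (by linarith)]
    rw [a_eq, norm_neg, norm_mul, norm_mul, norm_pow, Complex.norm_conj, hzc]
    have h2y : (2 * y) ^ n * E₁ ≤ Ma₀ := by
      have := hMa y him0.le
      rw [zero_add] at this
      exact this.trans (le_max_left _ _)
    calc ‖φ (ofComplex z)‖ * ‖ψ (ofComplex z)‖ * (2 * y) ^ n
        ≤ (Cφ * E₁) * (Cψ * E₂) * (2 * y) ^ n := by gcongr
      _ = Cφ * Cψ * ((2 * y) ^ n * E₁) * E₂ := by ring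
      _ ≤ Cφ * Cψ * Ma₀ * E₂ := by gcongr
  -- Step b: `‖b z‖ ≤ K (n Cψ + Cψ') Mb₀ E₂`
  have hb : ‖∑ j ∈ Finset.range (n + 1), ((n.choose j : ℂ) * powPrimitive j φ (ofComplex z)) *
      conj (((n - j : ℕ) : ℂ) * (-z) ^ (n - j - 1) * (-1) * ψ (ofComplex z) +
        (-z) ^ (n - j) * deriv (ψ ∘ ofComplex) z)‖ ≤ K * (n * Cψ + Cψ') * Mb₀ * E₂ := by
    have hBB : B ^ n * B ^ n * E₁ ≤ Mb₀ := by
      have := hMb y him0.le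
      rw [← pow_add]
      exact this.trans (le_max_left _ _)
    calc ‖∑ j ∈ Finset.range (n + 1), ((n.choose j : ℂ) * powPrimitive j φ (ofComplex z)) *
          conj (((n - j : ℕ) : ℂ) * (-z) ^ (n - j - 1) * (-1) * ψ (ofComplex z) +
            (-z) ^ (n - j) * deriv (ψ ∘ ofComplex) z)‖
        ≤ ∑ j ∈ Finset.range (n + 1), ‖((n.choose j : ℂ) * powPrimitive j φ (ofComplex z)) *
          conj (((n - j : ℕ) : ℂ) * (-z) ^ (n - j - 1) * (-1) * ψ (ofComplex z) +
            (-z) ^ (n - j) * deriv (ψ ∘ ofComplex) z)‖ := norm_sum_le _ _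
      _ ≤ ∑ j ∈ Finset.range (n + 1), ((n.choose j : ℝ) * Cp j) * (n * Cψ + Cψ') *
          (B ^ n * B ^ n * E₁) * E₂ := by
        refine Finset.sum_le_sum fun j hj ↦ ?_
        have hjn : j ≤ n := Nat.lt_succ_iff.mp (Finset.mem_range.mp hj)
        rw [norm_mul, Complex.norm_conj, norm_mul, Complex.norm_natCast]
        -- `‖u_j‖`
        have hu : ‖powPrimitive j φ (ofComplex z)‖ ≤ Cp j * B ^ n * E₁ := by
          have h1 := hCp j τ (by rw [hτim]; linarith)
          rw [hτim, hτre] at h1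
          refine h1.trans ?_
          have : (1 + |z.re| + y) ^ j ≤ B ^ n :=
            (pow_le_pow_left₀ (by positivity) hB2 j).trans (pow_le_pow_right₀ hB1 hjn)
          have hCpj := hCp0 j
          gcongr
        -- `‖v_j'‖`
        have hv : ‖((n - j : ℕ) : ℂ) * (-z) ^ (n - j - 1) * (-1) * ψ (ofComplex z) +
            (-z) ^ (n - j) * deriv (ψ ∘ ofComplex) z‖ ≤ B ^ n * (n * Cψ + Cψ') * E₂ := by
          refine (norm_add_le _ _).trans ?_
          rw [norm_mul, norm_mul, norm_mul, norm_neg, norm_one, mul_one, norm_pow, norm_neg,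
            norm_mul, norm_pow, norm_neg, Complex.norm_natCast]
          have hnj : ((n - j : ℕ) : ℝ) ≤ n := by exact_mod_cast Nat.sub_le n j
          have hp1 := hzpow (n - j - 1) (by omega)
          have hp2 := hzpow (n - j) (by omega)
          calc ((n - j : ℕ) : ℝ) * ‖z‖ ^ (n - j - 1) * ‖ψ (ofComplex z)‖ +
                ‖z‖ ^ (n - j) * ‖deriv (ψ ∘ ofComplex) z‖
              ≤ (n : ℝ) * B ^ n * (Cψ * E₂) + B ^ n * (Cψ' * E₂) := by gcongr
            _ = B ^ n * (n * Cψ + Cψ') * E₂ := by ring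
        calc (n.choose j : ℝ) * ‖powPrimitive j φ (ofComplex z)‖ *
              ‖((n - j : ℕ) : ℂ) * (-z) ^ (n - j - 1) * (-1) * ψ (ofComplex z) +
                (-z) ^ (n - j) * deriv (ψ ∘ ofComplex) z‖
            ≤ (n.choose j : ℝ) * (Cp j * B ^ n * E₁) * (B ^ n * (n * Cψ + Cψ') * E₂) := by
              have := hCp0 j
              gcongr
          _ = ((n.choose j : ℝ) * Cp j) * (n * Cψ + Cψ') * (B ^ n * B ^ n * E₁) * E₂ := by ring
      _ = K * (n * Cψ + Cψ') * (B ^ n * B ^ n * E₁) * E₂ := by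
        rw [hK, Finset.sum_mul, Finset.sum_mul, Finset.sum_mul]
      _ ≤ K * (n * Cψ + Cψ') * Mb₀ * E₂ := by gcongr
  calc _ ≤ _ := norm_clm_le _ _
    _ ≤ Cφ * Cψ * Ma₀ * E₂ + K * (n * Cψ + Cψ') * Mb₀ * E₂ := add_le_add ha hb
    _ = (Cφ * Cψ * Ma₀ + K * (n * Cψ + Cψ') * Mb₀) * E₂ := by ring

end Bounds

/-! ### The package of hypotheses for Green's theorem -/

section Package

open UpperHalfPlane hiding I

variable {n : ℕ} {h₁ h₂ : ℝ} {φ ψ : ℍ → ℂ}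

/-- `re z ∈ [a, b]` implies `|re z| ≤ max |a| |b|`. [folklore] -/
theorem abs_re_le_of_mem_Icc {z : ℂ} {a b : ℝ} (h : z.re ∈ Icc a b) : |z.re| ≤ max |a| |b| := by
  rw [abs_le]
  constructor
  · have : -max |a| |b| ≤ a := by
      have := neg_abs_le a
      have := le_max_left |a| |b|
      linarith
    exact this.trans h.1
  · exact h.2.trans ((le_abs_self b).trans (le_max_right _ _))

/-- **All hypotheses of Green's theorem for `P = F ψ̄`** (`F(z) = ∫_z^{i∞} φ(t)(t - z̄)ⁿ dt`,
`φ, ψ` cusp functions): a continuous derivative field `P'` on the upper half-plane with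
`DP = P'`, exponential bounds `‖P‖, ‖P'‖ ≤ C e^{-(2π/h₂) y}` on `[a, b] × [1/2, ∞)`, and the Stokes
integrand `-i P'1 - P'i = (2i)ⁿ⁺¹ yⁿ φ ψ̄`. [folklore] -/
theorem integrand_package (hφ : IsCuspFunction h₁ φ) (hψ : IsCuspFunction h₂ ψ) (n : ℕ) (a b : ℝ) :
    ∃ (P' : ℂ → ℂ →L[ℝ] ℂ) (C : ℝ), 0 ≤ C ∧
      (∀ z : ℂ, 0 < z.im → HasFDerivAt
        (fun w : ℂ ↦ eichlerKernel n φ (ofComplex w) ![conj w, 1] * conj (ψ (ofComplex w))) (P' z) z) ∧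
      ContinuousOn P' {z : ℂ | 0 < z.im} ∧
      (∀ z : ℂ, z.re ∈ Icc a b → 1 / 2 ≤ z.im →
        ‖eichlerKernel n φ (ofComplex z) ![conj z, 1] * conj (ψ (ofComplex z))‖ ≤
          C * Real.exp (-(2 * Real.pi / h₂) * z.im)) ∧
      (∀ z : ℂ, z.re ∈ Icc a b → 1 / 2 ≤ z.im → ‖P' z‖ ≤ C * Real.exp (-(2 * Real.pi / h₂) * z.im)) ∧
      (∀ z : ℂ, 0 < z.im → -I * P' z 1 - P' z I =
        (2 * I) ^ (n + 1) * (z.im : ℂ) ^ n * (φ (ofComplex z) * conj (ψ (ofComplex z)))) := by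
  set P' : ℂ → ℂ →L[ℝ] ℂ := fun z ↦
    (∑ j ∈ Finset.range (n + 1), conj ((-z) ^ (n - j) * ψ (ofComplex z)) *
        ((n.choose j : ℂ) * (-(φ (ofComplex z) * z ^ j)))) • ContinuousLinearMap.id ℝ ℂ +
      (∑ j ∈ Finset.range (n + 1), ((n.choose j : ℂ) * powPrimitive j φ (ofComplex z)) *
        conj (((n - j : ℕ) : ℂ) * (-z) ^ (n - j - 1) * (-1) * ψ (ofComplex z) +
          (-z) ^ (n - j) * deriv (ψ ∘ ofComplex) z)) • (conjCLE : ℂ →L[ℝ] ℂ) with hP'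
  have hderiv : ∀ z : ℂ, 0 < z.im → HasFDerivAt
      (fun w : ℂ ↦ eichlerKernel n φ (ofComplex w) ![conj w, 1] * conj (ψ (ofComplex w))) (P' z) z :=
    fun z hz ↦ hasFDerivAt_integrand hφ hψ hz
  have hcontP : ContinuousOn
      (fun w : ℂ ↦ eichlerKernel n φ (ofComplex w) ![conj w, 1] * conj (ψ (ofComplex w))) {z : ℂ | 0 < z.im} :=
    fun z hz ↦ (hderiv z hz).continuousAt.continuousWithinAt
  have hcontP' : ContinuousOn P' {z : ℂ | 0 < z.im} := continuousOn_fderiv_integrand hφ hψ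
  set R : ℝ := max |a| |b|
  obtain ⟨C₁, hC₁0, hC₁⟩ := exists_norm_integrand_le hφ hψ n R
  obtain ⟨C₂, hC₂0, hC₂⟩ := exists_norm_fderiv_integrand_le hφ hψ n R
  obtain ⟨C₁', hC₁'0, hC₁'⟩ := exists_bound_of_bound_ge hcontP (a := a) (b := b) (Y := 1) (m := 1 / 2)
    (C := C₁) (c := 2 * Real.pi / h₂) one_half_pos
    (fun z hz him ↦ hC₁ z (abs_re_le_of_mem_Icc hz) him)
  obtain ⟨C₂', hC₂'0, hC₂'⟩ := exists_bound_of_bound_ge hcontP' (a := a) (b := b) (Y := 2) (m := 1 / 2)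
    (C := C₂) (c := 2 * Real.pi / h₂) one_half_pos
    (fun z hz him ↦ hC₂ z (abs_re_le_of_mem_Icc hz) him)
  refine ⟨P', max C₁' C₂', le_max_of_le_left hC₁'0, hderiv, hcontP', fun z hz him ↦ ?_,
    fun z hz him ↦ ?_, fun z hz ↦ ?_⟩
  · exact (hC₁' z hz him).trans (by gcongr; exact le_max_left _ _)
  · exact (hC₂' z hz him).trans (by gcongr; exact le_max_right _ _)
  · exact stokes_integrand_eq n φ ψ z _ _ (a_eq n φ ψ z)

end Package

/-! ### Green's theorem on the standard fundamental domain for `P = F ψ̄` -/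

section Fd

open UpperHalfPlane hiding I

variable {n : ℕ} {h₁ h₂ : ℝ} {φ ψ : ℍ → ℂ}

/-- The lower boundary `x ↦ √(1 - x²)` of `𝒟` is differentiable on `[-1/2, 1/2]` with derivative
`-x/√(1 - x²)`. [folklore] -/
theorem hasDerivAt_arc {x : ℝ} (hx : x ∈ Icc (-(1 / 2) : ℝ) (1 / 2)) :
    HasDerivAt (fun x : ℝ ↦ Real.sqrt (1 - x ^ 2)) (-x / Real.sqrt (1 - x ^ 2)) x := by
  have hx2 : x ^ 2 ≤ 1 / 4 := by
    have h : |x| ≤ 1 / 2 := abs_le.mpr ⟨by linarith [hx.1], hx.2⟩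
    have h' : |x| ^ 2 ≤ (1 / 2) ^ 2 := by gcongr
    rw [sq_abs] at h'
    linarith
  have hpos : 0 < 1 - x ^ 2 := by linarith
  have h1 : HasDerivAt (fun x : ℝ ↦ 1 - x ^ 2) (0 - (2 : ℕ) * x ^ (2 - 1)) x :=
    (hasDerivAt_const x (1 : ℝ)).sub (hasDerivAt_pow 2 x)
  refine (h1.sqrt hpos.ne').congr_deriv ?_
  have hs : Real.sqrt (1 - x ^ 2) ≠ 0 := (Real.sqrt_pos.mpr hpos).ne'
  field_simp
  push_cast
  ring

/-- Continuity of `x ↦ -x/√(1 - x²)` on `[-1/2, 1/2]`. [folklore] -/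
theorem continuousOn_arc_deriv :
    ContinuousOn (fun x : ℝ ↦ -x / Real.sqrt (1 - x ^ 2)) (Icc (-(1 / 2) : ℝ) (1 / 2)) := by
  refine ContinuousOn.div (by fun_prop) (by fun_prop) fun x hx ↦ ?_
  have hx2 : x ^ 2 ≤ 1 / 4 := by
    have h : |x| ≤ 1 / 2 := abs_le.mpr ⟨by linarith [hx.1], hx.2⟩
    have h' : |x| ^ 2 ≤ (1 / 2) ^ 2 := by gcongr
    rw [sq_abs] at h'
    linarith
  exact (Real.sqrt_pos.mpr (by linarith)).ne'

/-- On `[-1/2, 1/2]` the boundary arc lies above height `1/2` (indeed `√3/2`). [folklore] -/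
theorem half_le_arc {x : ℝ} (hx : x ∈ Icc (-(1 / 2) : ℝ) (1 / 2)) : 1 / 2 ≤ Real.sqrt (1 - x ^ 2) := by
  have hx2 : x ^ 2 ≤ 1 / 4 := by
    have h : |x| ≤ 1 / 2 := abs_le.mpr ⟨by linarith [hx.1], hx.2⟩
    have h' : |x| ^ 2 ≤ (1 / 2) ^ 2 := by gcongr
    rw [sq_abs] at h'
    linarith
  refine Real.le_sqrt_of_sq_le ?_
  linarith

/-- **Stokes' theorem on the standard fundamental domain for `P = F ψ̄`**
(`F(z) = ∫_z^{i∞} φ(t)(t - z̄)ⁿ dt`, `φ, ψ` cusp functions): with `z(x) = x + i√(1 - x²)` the bottom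
arc of `𝒟 = {|x| ≤ 1/2, |z| ≥ 1}`,
`(2i)ⁿ⁺¹ ∫_{-1/2}^{1/2} ∫_{√(1-x²)}^∞ yⁿ φ ψ̄ dy dx
   = ∫_{-1/2}^{1/2} P(z(x)) \overline{z'(x)} dx - i∫_{√3/2}^∞ P(1/2 + it) dt + i∫_{√3/2}^∞ P(-1/2 + it) dt`,
i.e. `∫_𝒟 φ ψ̄ (z - z̄)ⁿ dz dz̄ = -∮_{∂𝒟} P dz̄` (Paşol–Popa §8.2, first display of the proof of
Thm. 8.6 with `a_A = b_A = 0`: `C_k C_Γ (f,g) = ∑_A ∫_{∂𝔉} -F_A ḡ_A dz̄`). [cite: PasolPopa2013, §8.2 (proof of Thm. 8.6) and Thm. 3.2] -/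
theorem stokes_fd (hφ : IsCuspFunction h₁ φ) (hψ : IsCuspFunction h₂ ψ) (n : ℕ) :
    (2 * I) ^ (n + 1) * ∫ x in (-(1 / 2) : ℝ)..(1 / 2), ∫ y in Ioi (Real.sqrt (1 - x ^ 2)),
        (y : ℂ) ^ n * (φ (ofComplex ((x : ℂ) + y * I)) * conj (ψ (ofComplex ((x : ℂ) + y * I)))) =
      (∫ x in (-(1 / 2) : ℝ)..(1 / 2),
        (eichlerKernel n φ (ofComplex ((x : ℂ) + Real.sqrt (1 - x ^ 2) * I))
            ![conj ((x : ℂ) + Real.sqrt (1 - x ^ 2) * I), 1] *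
          conj (ψ (ofComplex ((x : ℂ) + Real.sqrt (1 - x ^ 2) * I)))) *
        (1 - ((-x / Real.sqrt (1 - x ^ 2) : ℝ) : ℂ) * I)) -
      I * (∫ t in Ioi (Real.sqrt (1 - (1 / 2 : ℝ) ^ 2)),
        eichlerKernel n φ (ofComplex ((((1 / 2 : ℝ)) : ℂ) + t * I)) ![conj ((((1 / 2 : ℝ)) : ℂ) + t * I), 1] *
          conj (ψ (ofComplex ((((1 / 2 : ℝ)) : ℂ) + t * I)))) +
      I * (∫ t in Ioi (Real.sqrt (1 - (-(1 / 2) : ℝ) ^ 2)),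
        eichlerKernel n φ (ofComplex (((-(1 / 2) : ℝ) : ℂ) + t * I)) ![conj (((-(1 / 2) : ℝ) : ℂ) + t * I), 1] *
          conj (ψ (ofComplex (((-(1 / 2) : ℝ) : ℂ) + t * I)))) := by
  have hh₂ := hψ.pos
  obtain ⟨P', C, hC0, hderiv, hcontP', hbP, hbP', hstokes⟩ := integrand_package hφ hψ n (-(1 / 2)) (1 / 2)
  have hG := green_dzbar (P := fun w : ℂ ↦ eichlerKernel n φ (ofComplex w) ![conj w, 1] * conj (ψ (ofComplex w)))
    (P' := P') (φ := fun x : ℝ ↦ Real.sqrt (1 - x ^ 2)) (φ' := fun x : ℝ ↦ -x / Real.sqrt (1 - x ^ 2))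
    (a := -(1 / 2)) (b := 1 / 2) (m := 1 / 2) (C := C) (c := 2 * Real.pi / h₂)
    hderiv hcontP' hbP hbP' hC0 one_half_pos (by positivity) (by norm_num)
    (fun x hx ↦ hasDerivAt_arc hx) continuousOn_arc_deriv (fun x hx ↦ half_le_arc hx)
  rw [← hG]
  -- the Stokes integrand is `(2i)ⁿ⁺¹ yⁿ φ ψ̄`
  rw [← intervalIntegral.integral_const_mul]
  refine intervalIntegral.integral_congr fun x _ ↦ ?_
  rw [← integral_const_mul]
  refine setIntegral_congr_fun measurableSet_Ioi fun y hy ↦ ?_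
  have hy0 : 0 < y := (Real.sqrt_nonneg _).trans_lt hy
  have him : 0 < ((x : ℂ) + y * I).im := by simpa using hy0
  rw [hstokes _ him]
  have e : ((x : ℂ) + y * I).im = y := by simp
  rw [e]
  ring

end Fd

end HaberlandStokes

end Literature.NumberTheory.EllipticCurves.ModularForms
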